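import Mathlib
import Literature.MathematicalPhysics.QuantumFieldTheory.Balaban1983to89.B9SectECov

/-! # `Balaban1983to89.B9Eq3166` — B9 Sect. E p. 429, (3.160), (3.161), (3.165), (3.166) and the configuration of
# (3.167): the Faddeev–Popov λ-integration AT MEASURE LEVEL — Lebesgue integrals over subspaces in a basis, the
# Jacobian `|det(Δ↾_{N(Q′)})|`, and the evaluation point `λ′ = −G′RD*A`, kernel-checked

CITATION HEADER.  Unit `b2b-balaban-b09` (gen 14, cell pub-balaban), PAPER SUB-CELL B09 =
T. Balaban, *Propagators for lattice gauge theories in a background field*, Commun. Math. Phys. **99** (1985) 389–434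
[`Balaban1985BackgroundPropagators`] (= B9).  Sect. E, p. 429 [PDF 41] (render
`1985-cmp99-background-propagators-p041-x2.png`, READ AS AN IMAGE — the Euclid text layer is unreliable):
*"We apply the Faddeev–Popov procedure inserting the identity
1 = |det(Δ↾_{N(Q̃′)})| ∫dλ δ(Q̃′λ)δ_R̃(R̃D\*A − Δλ). (3.160)
As usual we change the order of integrations and in the A-integral we make the gauge transformation A → A + Dλ."*
[(3.161) then carries the factors `δ(Q′λ − μ)`, `δ_R(RD*A + RΔλ)` and `δ_R̃(R̃D*A)` — PRINT SLIP, stated per the v1.1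
DOCFIX below: lines 4–5 of the printed (3.161) read *"× δ_R̃(RD\*A + RΔλ) … × δ_R(R̃D\*A)"* with the two δ-SUBSCRIPTS
INTERCHANGED; the reading just given (unwavy δ on `R` in the unwavy variable `RD*A + RΔλ`, wavy δ on `R̃` in `R̃D*A`) is
the one forced by (3.160) itself (`δ_R̃(R̃D*A − Δλ)`) and by p. 430 (3.167) (*"δ_R̃(R̃D\*A)"*), and is what §5 types] …
*"The translation λ = λ′ + H′μ
changes the expressions dependent on λ in (3.161) in the following way
δ(Q′λ − μ) = δ(Q′λ), D̄Q′λ = D̄Q′λ′ + D̄Q′H′μ = D̄μ, RΔλ = RΔλ′ = Δλ′, Dλ = Dλ′ + DH′μ. (3.165)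
The λ′-integral can be easily calculated, and we have
∫dλ′ δ(Q′λ′)δ_R(RD\*A + Δλ′)F(λ′) = |det(Δ↾_{N(Q′)})|⁻¹F(−G′RD\*A) (3.166)
for an arbitrary function F(λ′)."*, and p. 430 [PDF 42] (render `…-p042-x2.png`) (3.167), whose exponent carries the
configuration *"A − DG′RD\*A + DH′μ"* and whose constant `Z⁻¹` absorbs `(Z^{(k)}(Λ))⁻¹Z_k⁻¹|det(Δ↾_{N(Q̃′)})|` of (3.161)
and `|det(Δ↾_{N(Q′)})|⁻¹` of (3.166).  With p. 394 [PDF 6] (3.20)–(3.21) (*"R = R(U) is an orthogonal projection … onto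
the subspace R = Δ^η_U N(Q′)"*), (3.25) (*"Rf = (I − G′Q′\*(Q′G′²Q′\*)⁻¹Q′G′)f, where G′ = G′(U) = (Δ′_a)⁻¹"*) and (3.23)
(`Δ^η_U = D^{η*}_U D^η_U`).  The step is B6 = [`Balaban1984PropagatorsII`] (CMP 96:223) pp. 241–242 (2.97)–(2.105) by the
paper's own pointer (*"Our next step is similar to the one in [4] yielding the formula (2.105) from (2.97)"*).

THE POINT.  The cell has Sect. E line by line BY HAND twice (GAPS C-adv8-2, C-adv4-55: "(3.160) FP identity (λ = G̃′R̃D\*A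
unique in N(Q̃′), Jacobian = det(Δ : N(Q̃′) → ΔN(Q̃′))) … (3.166) λ′ = −G′RD\*A ∈ N(Q′) … (3.167) incl. the two determinants
absorbed in Z") and in the KERNEL the operator identities around it ([adv1's] `B9H163`: (3.162)–(3.164); this lineage's
`B9SectECov` §§7–8: (3.171)–(3.175) at measure level, `R = ΔN(NᵀΔ²N)⁻¹NᵀΔ`, `G′R = 𝒢Δ`).  What was NOT in the kernel is
the δ-FUNCTION CALCULUS of (3.160)/(3.166) itself: the meaning of `∫dλ′ δ(Q′λ′)(…)` as a Lebesgue integral over the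
subspace `N(Q′)`, of `δ_R` as the δ-function OF THE SUBSPACE `R = ΔN(Q′)`, and of the constant `|det(Δ↾_{N(Q′)})|` — the
absolute determinant of `Δ↾N(Q′) : N(Q′) → ΔN(Q′)` between two DIFFERENT subspaces of `ℝⁿ` with their induced Euclidean
structures.  This file types them (C-B9-57 residual (i), first half).

DICTIONARY / READING (extends D-b09.45 (b): "`∫dλ δ(Q′λ − μ)F` ↦ `∫ F(H′μ + Nz) dz` over a kernel basis").  Finite index
types, real scalars, the Lie-algebra index absorbed into the site index `n` (as in `B9H163`, `B9SectECov`); `ℝⁿ = n → ℝ`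
with the dot product (so `Q′* = Q′ᵀ`, and "orthogonal projection" = symmetric idempotent).  `Δ : Matrix n n ℝ` SYMMETRIC
(= `Δ^η_U`; invertibility of `Δ` is NOT used), `Q = Q′ : Matrix m n ℝ` with `Q′Q′ᵀ` nonsingular, `a` the scalar of (3.24),
`Δ′_a`, `G′ = (Δ′_a)⁻¹`, `R` = (3.25), `H′ = H163 = Hmin` = [adv1's] `B9H163.Δ'/G'/R/H163/Hmin` BY NAME; a KERNEL BASIS
`N : Matrix n τ ℝ` of `Q′` (`Q′N = 0`, `NᵀN` nonsingular, `n ≃ τ ⊕ m`) as in `B9SectECov` §§2, 7, 8, with `Δ` injective on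
`N(Q′)` (`NᵀΔ²N` nonsingular).  The bond field `A : b → ℝ` and an abstract derivative `D : Matrix b n ℝ` with `Δ = DᵀD`
((3.23)) enter §5 only.
* `subInt N f := √det(NᵀN) · ∫ f(Nz) dz` (Lebesgue measure on `τ → ℝ`) = the `|τ|`-dimensional Lebesgue (Hausdorff)
  integral of `f` over the SUBSPACE `Ran N ⊂ ℝⁿ`; `subInt_basis`: it does not depend on the basis (`N ↦ NP`, `P`
  nonsingular) — so "`∫dλ′ δ(Q′λ′) F(λ′)`" := `subInt N F` is a functional of the subspace `N(Q′)` alone, and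
  "`∫_R dw ψ(w)`" := `subInt (ΔN) ψ` one of `R = ΔN(Q′)` alone.  (The print's `Z′`-normalised Gaussian readings of
  `B9SectECov` are `subInt` up to the constant `√det(NᵀN)`, which cancels there; here nothing is normalised, so the
  Euclidean factor is kept.)
* `absDetOn Δ N := √(det((ΔN)ᵀΔN) / det(NᵀN))` = `|det(Δ↾_V)|`, `V = Ran N`, the volume distortion of `Δ↾V : V → ΔV`
  between the induced Euclidean structures: basis-independent (`absDetOn_basis`), `= |det Δ|` for `V = ℝⁿ`
  (`absDetOn_one`), and `= |det(EᵀΔN)|` = the ordinary absolute determinant of the matrix of `Δ↾V` in ORTHONORMAL bases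
  `N` of `V`, `E` of `ΔV` (`absDetOn_orthonormal`).
* `δ_R(w + Δλ′)` for the OUTER variable `w = RD*A ∈ R`: (3.160)/(3.166) are identities between functions of `A` through
  `w = RD*A` (resp. `R̃D*A`), used under the `A`-integral; integrating them against a test function of `w` over the
  subspace `R` and doing the `w`-integral first (the δ-function of the subspace `R` in its own variable = evaluation)
  turns each into a CHANGE OF VARIABLES `w = ∓Δλ′` between `N(Q′)` and `R = ΔN(Q′)` — `eq_3160`, `eq_3166` below — and
  the support statement "the two δ-functions cut out exactly `λ′ = −G′Rw`" is `eq_3166_point`.  Nothing distributional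
  is postulated: every theorem is an identity of Lebesgue integrals or of vectors.

WHAT THIS FILE CERTIFIES (kernel, zero sorry):
1. §1 `subInt_basis`, `subInt_one`, `subInt_orthonormal`, `subInt_comp_neg` — the subspace integral is well defined on
   subspaces and symmetric under `λ ↦ −λ` ([pv16's] `Beta.GaussianIntegral.integral_comp_mulVec`, by name).
2. §2 `absDetOn_basis`, `absDetOn_one`, `absDetOn_orthonormal`, `absDetOn_pos` — `|det(Δ↾_{N(Q′)})|` is a number attached
   to the pair (`Δ`, subspace), positive when `Δ` is injective on the subspace.
3. §3 `eq_3160` — **(3.160)**: `∫_{ΔV} ψ(w) dw = |det(Δ↾_V)| · ∫_V ψ(Δλ) dλ` for ANY `Δ`, `V = Ran N` (the inserted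
   "1" integrates test functions of `w = R̃D*A` correctly: `|det(Δ↾_{N(Q̃′)})| ∫dλ δ(Q̃′λ)δ_R̃(w − Δλ)` is the unit density
   on `R̃`), `eq_3160_inv`, `subInt_image_basis`; and (§4) `eq_3160_point` — for each `f = D*A` the δ-functions cut out
   the single point `λ = G̃′R̃f ∈ N(Q̃′)` (`Q̃′λ = 0 ∧ R̃f − Δλ = 0 ↔ λ = G̃′R̃f`).
4. §4 `eq_3166` — **(3.166)** tested against the outer variable: for every `Φ(w, λ′)` (the "arbitrary function F(λ′)",
   allowed to depend on `A` through `w` as it does in (3.161)),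
   `∫_{N(Q′)} Φ(−Δλ′, λ′) dλ′ = |det(Δ↾_{N(Q′)})|⁻¹ ∫_R Φ(w, −G′Rw) dw`, `R = ΔN(Q′)` (`Rw = w` on `R`:
   `R_mulVec_Δ_kernel`; `G′Δ = 1` on `N(Q′)`: `G'_mulVec_Δ_kernel`); `eq_3166_F` — the literal shape with `F(λ′)` and a
   test function `ψ(w)`; `eq_3166_point` — `Q′λ′ = 0 ∧ Rf + Δλ′ = 0 ↔ λ′ = −G′Rf` (existence AND uniqueness of the
   evaluation point, for every `f = D*A`; `kernel_eq_mulVec`: `N(Q′) = Ran N` by [an2's] `proj_add_proj`); `R_mulVec_mem`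
   — `Rf ∈ ΔN(Q′)` (the argument of `δ_R` lies in the subspace `R`); `G'R_eq` — `G′R = N(NᵀΔ²N)⁻¹NᵀΔ` (= `𝒢Δ`,
   `B9SectECov.eq_3172`); `absDetOn_kernel_pos` — the Jacobian is a positive number under the standing hypotheses
   (`Δ` symmetric, `NᵀN` and `NᵀΔ²N` nonsingular — invertibility of `Δ` itself is never used).
5. §5 `eq_3161_R`, `eq_3161_wavy` — the two substitutions of (3.161) under `A → A + Dλ` (`RD*(A + Dλ) = RD*A + RΔλ`;
   `R̃D*(A + Dλ) − Δλ = R̃D*A` for `Q̃′λ = 0`); `eq_3165_constraint`, `eq_3165_R` — **(3.165)** (`Q′(λ′ + H′μ) − μ = Q′λ′`,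
   `RΔ(λ′ + H′μ) = RΔλ′ = Δλ′` for `Q′λ′ = 0`); `eq_3167_config` — the configuration `A + D(λ′ + H′μ) = A − DG′RD*A + DH′μ`
   of **(3.167)** at `λ′ = −G′RD*A`.
NOT CERTIFIED HERE (located, by hand in the cell): the order-of-integration / Fubini bookkeeping of the full (3.159)–(3.161)
(C-adv8-2, C-adv4-55), the boundary-bond convention G-adv8-1, the `μ`-integral (3.168)–(3.170) and its Jacobian
(C-B9-57 (i), second half), the identification `Z⁻¹ = (Z^{(k)}(Λ))⁻¹Z_k⁻¹|det(Δ↾_{N(Q̃′)})||det(Δ↾_{N(Q′)})|⁻¹`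
(which DEFINES `Z`), and everything analytic (Thm 3.15 stays under G-B9-10).  Elementary; [folklore] (Lebesgue measure
under linear maps, Gram determinants) + the paper's operators BY NAME; no Literature `def` is restated.  NOT summit
progress; NOT continuum; NOT Clay.

v1.1 (DOCFIX, header and two docstrings ONLY — every declaration of v1 unchanged, byte for byte): states the print slip in
(3.161) p. 429 (δ-subscripts `R̃`/`R` interchanged on its lines 4–5) which v1's bracketed paraphrase corrected silently —
owed per the cross-read of v1 recorded in the cell as GAPS C-adv9-95 (render crop of (3.161) re-read as an image by this
seat: the slip is real and confined to those two subscripts; (3.160), (3.165)–(3.167) are printed consistently). -/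

namespace Literature.MathematicalPhysics.QuantumFieldTheory.Balaban1983to89.B9Eq3166

open Matrix MeasureTheory

noncomputable section

/-! ## §1  The Lebesgue integral over a subspace of `ℝⁿ`, in a basis -/

section SubInt

variable {n τ : Type*} [Fintype n] [Fintype τ] [DecidableEq τ]

/-- A Gram determinant is nonnegative. [folklore] -/
theorem gram_det_nonneg (N : Matrix n τ ℝ) : 0 ≤ (Nᵀ * N).det := by
  simpa only [conjTranspose_eq_transpose_of_trivial] using
    (Matrix.posSemidef_conjTranspose_mul_self N).det_nonneg

/-- A nonsingular Gram determinant is positive. [folklore] -/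
theorem gram_det_pos {N : Matrix n τ ℝ} (h : IsUnit (Nᵀ * N).det) : 0 < (Nᵀ * N).det :=
  lt_of_le_of_ne (gram_det_nonneg N) (fun h0 => h.ne_zero h0.symm)

omit [Fintype τ] [DecidableEq τ] in
/-- `(ΔN)ᵀ(ΔN) = NᵀΔ²N` for symmetric `Δ`. [folklore] -/
theorem gram_image (Δ : Matrix n n ℝ) (hΔ : Δ.IsSymm) (N : Matrix n τ ℝ) :
    (Δ * N)ᵀ * (Δ * N) = Nᵀ * (Δ * Δ) * N := by
  rw [Matrix.transpose_mul Δ N, hΔ.eq]; simp only [Matrix.mul_assoc]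

/-- `∫_{Ran N} f` — the `|τ|`-dimensional LEBESGUE INTEGRAL OVER THE SUBSPACE `Ran N ⊂ ℝⁿ` (dot-product Euclidean
structure), written in the basis `N`: `√det(NᵀN) · ∫ f(Nz) dz`.  READING of B9's `∫dλ′ δ(Q′λ′) f(λ′)` (`N` a kernel basis
of `Q′`) and of `∫_R dw ψ(w)` over the subspace `R = ΔN(Q′)` (basis `ΔN`). [folklore] -/
def subInt (N : Matrix n τ ℝ) (f : (n → ℝ) → ℝ) : ℝ :=
  Real.sqrt ((Nᵀ * N).det) * ∫ z : τ → ℝ, f (N *ᵥ z)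

/-- BASIS INDEPENDENCE: `∫_{Ran (NP)} f = ∫_{Ran N} f` for nonsingular `P` — the subspace integral is a functional of the
subspace (Lebesgue measure under the linear automorphism `P` of `τ → ℝ`: [pv16's]
`Beta.GaussianIntegral.integral_comp_mulVec`, by name). [folklore] -/
theorem subInt_basis (N : Matrix n τ ℝ) (P : Matrix τ τ ℝ) (hP : IsUnit P.det) (f : (n → ℝ) → ℝ) :
    subInt (N * P) f = subInt N f := by
  unfold subInt
  have hgram : (N * P)ᵀ * (N * P) = Pᵀ * (Nᵀ * N) * P := by
    rw [Matrix.transpose_mul N P]; simp only [Matrix.mul_assoc]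
  have hdet : ((N * P)ᵀ * (N * P)).det = P.det ^ 2 * (Nᵀ * N).det := by
    rw [hgram, det_mul, det_mul, det_transpose]; ring
  have hsqrt : Real.sqrt (((N * P)ᵀ * (N * P)).det) = |P.det| * Real.sqrt ((Nᵀ * N).det) := by
    rw [hdet, Real.sqrt_mul (sq_nonneg _), Real.sqrt_sq_eq_abs]
  have hint : ∫ z : τ → ℝ, f ((N * P) *ᵥ z) = |P.det|⁻¹ * ∫ z : τ → ℝ, f (N *ᵥ z) := by
    simp_rw [← mulVec_mulVec]
    exact Beta.GaussianIntegral.integral_comp_mulVec P hP.ne_zero (fun w => f (N *ᵥ w))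
  have hP0 : |P.det| ≠ 0 := abs_ne_zero.mpr hP.ne_zero
  rw [hsqrt, hint, mul_mul_mul_comm, mul_inv_cancel₀ hP0, one_mul]

/-- In an ORTHONORMAL basis (`NᵀN = 1`) the subspace integral is the plain coordinate integral. [folklore] -/
theorem subInt_orthonormal (N : Matrix n τ ℝ) (hN : Nᵀ * N = 1) (f : (n → ℝ) → ℝ) :
    subInt N f = ∫ z : τ → ℝ, f (N *ᵥ z) := by
  unfold subInt; rw [hN, det_one, Real.sqrt_one, one_mul]

/-- The subspace integral is symmetric under `λ ↦ −λ` (Lebesgue measure under `−1`). [folklore] -/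
theorem subInt_comp_neg (N : Matrix n τ ℝ) (f : (n → ℝ) → ℝ) : subInt N (fun l => f (-l)) = subInt N f := by
  unfold subInt
  congr 1
  have hdet : (-1 : Matrix τ τ ℝ).det ≠ 0 := by
    rw [det_neg, det_one, mul_one]; exact pow_ne_zero _ (by norm_num)
  calc ∫ z : τ → ℝ, f (-(N *ᵥ z)) = ∫ z : τ → ℝ, f (N *ᵥ ((-1 : Matrix τ τ ℝ) *ᵥ z)) := by
        simp_rw [neg_mulVec, one_mulVec, mulVec_neg]
    _ = |(-1 : Matrix τ τ ℝ).det|⁻¹ * ∫ z : τ → ℝ, f (N *ᵥ z) :=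
        Beta.GaussianIntegral.integral_comp_mulVec _ hdet (fun w => f (N *ᵥ w))
    _ = ∫ z : τ → ℝ, f (N *ᵥ z) := by
        rw [det_neg, det_one, mul_one, abs_pow, abs_neg, abs_one, one_pow, inv_one, one_mul]

/-- Constants come out of the subspace integral. [folklore] -/
theorem subInt_const_mul (N : Matrix n τ ℝ) (c : ℝ) (f : (n → ℝ) → ℝ) :
    subInt N (fun l => c * f l) = c * subInt N f := by
  unfold subInt; rw [integral_const_mul]; ring

/-- The whole space: `∫_{Ran 1} f = ∫_{ℝⁿ} f`. [folklore] -/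
theorem subInt_one {n : Type*} [Fintype n] [DecidableEq n] (f : (n → ℝ) → ℝ) :
    subInt (1 : Matrix n n ℝ) f = ∫ x : n → ℝ, f x := by
  unfold subInt
  simp only [transpose_one, det_one, Real.sqrt_one, one_mul, one_mulVec]

end SubInt

/-! ## §2  `|det(Δ↾_V)|` — the absolute determinant of `Δ` restricted to a subspace `V = Ran N` -/

section AbsDet

variable {n τ : Type*} [Fintype n] [Fintype τ] [DecidableEq τ]

/-- `|det(Δ↾_V)|`, `V = Ran N`: the volume distortion `√(det((ΔN)ᵀΔN)/det(NᵀN))` of `Δ↾V : V → ΔV` between the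
Euclidean structures induced from `ℝⁿ`.  READING of B9's `|det(Δ↾_{N(Q′)})|`, `|det(Δ↾_{N(Q̃′)})|`. [folklore] -/
def absDetOn (Δ : Matrix n n ℝ) (N : Matrix n τ ℝ) : ℝ :=
  Real.sqrt (((Δ * N)ᵀ * (Δ * N)).det / (Nᵀ * N).det)

/-- BASIS INDEPENDENCE of `|det(Δ↾_V)|`: `N ↦ NP`, `P` nonsingular. [folklore] -/
theorem absDetOn_basis (Δ : Matrix n n ℝ) (N : Matrix n τ ℝ) (P : Matrix τ τ ℝ) (hP : IsUnit P.det) :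
    absDetOn Δ (N * P) = absDetOn Δ N := by
  unfold absDetOn
  have h1 : (Δ * (N * P))ᵀ * (Δ * (N * P)) = Pᵀ * ((Δ * N)ᵀ * (Δ * N)) * P := by
    rw [← Matrix.mul_assoc Δ N P, Matrix.transpose_mul (Δ * N) P]; simp only [Matrix.mul_assoc]
  have h2 : (N * P)ᵀ * (N * P) = Pᵀ * (Nᵀ * N) * P := by
    rw [Matrix.transpose_mul N P]; simp only [Matrix.mul_assoc]
  rw [h1, h2, det_mul, det_mul, det_mul, det_mul, det_transpose, mul_div_mul_right _ _ hP.ne_zero,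
    mul_div_mul_left _ _ hP.ne_zero]

/-- ORTHONORMAL BASES: for `NᵀN = 1` and `E` with orthonormal columns (`EᵀE = 1`) whose span contains `ΔV`
(`EEᵀ(ΔN) = ΔN`), `|det(Δ↾_V)| = |det(EᵀΔN)|` — the ordinary absolute determinant of the matrix of `Δ↾V : V → ΔV` in
orthonormal coordinates (certifies the definition against the textbook one). [folklore] -/
theorem absDetOn_orthonormal (Δ : Matrix n n ℝ) (N E : Matrix n τ ℝ) (hN : Nᵀ * N = 1)
    (hEr : E * Eᵀ * (Δ * N) = Δ * N) : absDetOn Δ N = |(Eᵀ * (Δ * N)).det| := by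
  unfold absDetOn
  have h : (Eᵀ * (Δ * N))ᵀ * (Eᵀ * (Δ * N)) = (Δ * N)ᵀ * (Δ * N) := by
    rw [Matrix.transpose_mul Eᵀ (Δ * N), transpose_transpose, Matrix.mul_assoc, ← Matrix.mul_assoc E, hEr]
  rw [hN, det_one, div_one, ← h, det_mul, det_transpose, ← pow_two, Real.sqrt_sq_eq_abs]

/-- `0 < |det(Δ↾_V)|` when both Gram determinants are nonsingular (`Δ` injective on `V`). [folklore] -/
theorem absDetOn_pos (Δ : Matrix n n ℝ) (N : Matrix n τ ℝ) (hN : IsUnit (Nᵀ * N).det)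
    (hΔN : IsUnit ((Δ * N)ᵀ * (Δ * N)).det) : 0 < absDetOn Δ N :=
  Real.sqrt_pos.mpr (div_pos (gram_det_pos hΔN) (gram_det_pos hN))

/-- For symmetric `Δ`: `|det(Δ↾_V)|² = det(NᵀΔ²N)/det(NᵀN)` — the two Gram determinants of this lineage's `B9SectECov`
(`NᵀΔ²N` is its `T`, the matrix inverted in `R = ΔN(NᵀΔ²N)⁻¹NᵀΔ`). [folklore] -/
theorem absDetOn_sq (Δ : Matrix n n ℝ) (hΔ : Δ.IsSymm) (N : Matrix n τ ℝ) :
    absDetOn Δ N ^ 2 = (Nᵀ * (Δ * Δ) * N).det / (Nᵀ * N).det := by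
  unfold absDetOn
  rw [Real.sq_sqrt (div_nonneg (gram_det_nonneg _) (gram_det_nonneg _)), gram_image Δ hΔ N]

/-- The whole space: `|det(Δ↾_{ℝⁿ})| = |det Δ|`. [folklore] -/
theorem absDetOn_one {n : Type*} [Fintype n] [DecidableEq n] (Δ : Matrix n n ℝ) :
    absDetOn Δ (1 : Matrix n n ℝ) = |Δ.det| := by
  unfold absDetOn
  rw [Matrix.mul_one, transpose_one, Matrix.mul_one, det_one, div_one, det_mul, det_transpose, ← pow_two,
    Real.sqrt_sq_eq_abs]

end AbsDet

/-! ## §3  (3.160): the change of variables `w = Δλ` between `V` and `ΔV` -/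

section Eq3160

variable {n τ : Type*} [Fintype n] [Fintype τ] [DecidableEq τ]

/-- **(3.160) at measure level** — `∫_{ΔV} ψ(w) dw = |det(Δ↾_V)| · ∫_V ψ(Δλ) dλ` (`V = Ran N`, `NᵀN` nonsingular; ANY
square `Δ`): integrating the inserted identity *"1 = |det(Δ↾_{N(Q̃′)})| ∫dλ δ(Q̃′λ)δ_R̃(R̃D\*A − Δλ)"* against a test
function `ψ` of the outer variable `w = R̃D*A` over the subspace `R̃ = ΔN(Q̃′)` (`δ_R̃` in its own variable = evaluation at
`w = Δλ`) gives exactly this identity; i.e. the printed constant makes the inserted density the unit density on `R̃`.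
[cite: Balaban1985BackgroundPropagators, (3.160) p.429] -/
theorem eq_3160 (Δ : Matrix n n ℝ) (N : Matrix n τ ℝ) (hN : IsUnit (Nᵀ * N).det) (ψ : (n → ℝ) → ℝ) :
    subInt (Δ * N) ψ = absDetOn Δ N * subInt N (fun l => ψ (Δ *ᵥ l)) := by
  unfold subInt absDetOn
  simp_rw [mulVec_mulVec]
  rw [← mul_assoc]
  congr 1
  rw [Real.sqrt_div' _ (gram_det_nonneg N), div_mul_cancel₀ _ (Real.sqrt_ne_zero'.mpr (gram_det_pos hN))]

/-- The same with the Jacobian on the other side: `∫_V ψ(Δλ) dλ = |det(Δ↾_V)|⁻¹ · ∫_{ΔV} ψ(w) dw` (`Δ` injective on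
`V`). [cite: Balaban1985BackgroundPropagators, (3.160),(3.166) p.429] -/
theorem eq_3160_inv (Δ : Matrix n n ℝ) (N : Matrix n τ ℝ) (hN : IsUnit (Nᵀ * N).det)
    (hΔN : IsUnit ((Δ * N)ᵀ * (Δ * N)).det) (ψ : (n → ℝ) → ℝ) :
    subInt N (fun l => ψ (Δ *ᵥ l)) = (absDetOn Δ N)⁻¹ * subInt (Δ * N) ψ := by
  rw [eq_3160 Δ N hN ψ, ← mul_assoc, inv_mul_cancel₀ (absDetOn_pos Δ N hN hΔN).ne', one_mul]

/-- The `w`-integral over `R = ΔV` does not depend on the kernel basis either (`Δ(NP) = (ΔN)P`). [folklore] -/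
theorem subInt_image_basis (Δ : Matrix n n ℝ) (N : Matrix n τ ℝ) (P : Matrix τ τ ℝ) (hP : IsUnit P.det)
    (ψ : (n → ℝ) → ℝ) : subInt (Δ * (N * P)) ψ = subInt (Δ * N) ψ := by
  rw [← Matrix.mul_assoc, subInt_basis _ P hP]

end Eq3160

/-! ## §4  (3.166): the λ′-integral, with the paper's `R` (3.25) and `G′ = (Δ′_a)⁻¹` ([adv1's] `B9H163`, BY NAME) -/

section Eq3166

variable {n m τ : Type*} [Fintype n] [Fintype m] [Fintype τ] [DecidableEq n] [DecidableEq m] [DecidableEq τ]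

variable (e : n ≃ τ ⊕ m) (Δ : Matrix n n ℝ) (Q : Matrix m n ℝ) (a : ℝ)

include e in
/-- `N(Q′) = Ran N`: every `λ′` with `Q′λ′ = 0` is `N z` with `z = (NᵀN)⁻¹Nᵀλ′` ([an2's] projector decomposition
`Beta.LogDetHessian.proj_add_proj`: `N(NᵀN)⁻¹Nᵀ + Q′ᵀ(Q′Q′ᵀ)⁻¹Q′ = 1`, by name). [folklore] -/
theorem kernel_eq_mulVec (N : Matrix n τ ℝ) (hQN : Q * N = 0) (hNA : IsUnit (Nᵀ * N).det)
    (hQM : IsUnit (Q * Qᵀ).det) {l : n → ℝ} (hl : Q *ᵥ l = 0) :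
    l = N *ᵥ ((Nᵀ * N)⁻¹ *ᵥ (Nᵀ *ᵥ l)) := by
  have h' : N * ((Nᵀ * N)⁻¹ * Nᵀ) + Qᵀ * ((Q * Qᵀ)⁻¹ * Q) = 1 := by
    simpa only [Matrix.mul_assoc] using Beta.LogDetHessian.proj_add_proj e Q N hQN hNA hQM
  calc l = (1 : Matrix n n ℝ) *ᵥ l := (one_mulVec l).symm
    _ = (N * ((Nᵀ * N)⁻¹ * Nᵀ) + Qᵀ * ((Q * Qᵀ)⁻¹ * Q)) *ᵥ l := by rw [h']
    _ = N *ᵥ ((Nᵀ * N)⁻¹ *ᵥ (Nᵀ *ᵥ l)) + Qᵀ *ᵥ ((Q * Qᵀ)⁻¹ *ᵥ (Q *ᵥ l)) := by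
        simp only [add_mulVec, ← mulVec_mulVec]
    _ = N *ᵥ ((Nᵀ * N)⁻¹ *ᵥ (Nᵀ *ᵥ l)) := by rw [hl, mulVec_zero, mulVec_zero, add_zero]

omit [DecidableEq τ] in
/-- `R` FIXES the subspace `R = ΔN(Q′)` pointwise: `R(ΔNz) = ΔNz` (this lineage's `B9SectECov.R_mul_Δ_mul_kernel`, by
name) — the print's "RΔλ′ = Δλ′" of (3.165) and "R̃Δλ = Δλ" behind (3.161). [cite: Balaban1985BackgroundPropagators,
(3.165) p.429] -/
theorem R_mulVec_Δ_kernel (hΔ' : IsUnit (B9H163.Δ' Δ Q a)) (N : Matrix n τ ℝ) (hQN : Q * N = 0) (z : τ → ℝ) :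
    B9H163.R Δ Q a *ᵥ (Δ *ᵥ (N *ᵥ z)) = Δ *ᵥ (N *ᵥ z) := by
  have h := B9SectECov.R_mul_Δ_mul_kernel Δ Q a hΔ' N hQN
  calc B9H163.R Δ Q a *ᵥ (Δ *ᵥ (N *ᵥ z)) = (B9H163.R Δ Q a * (Δ * N)) *ᵥ z := by
        simp only [mulVec_mulVec, ← Matrix.mul_assoc]
    _ = Δ *ᵥ (N *ᵥ z) := by rw [h]; simp only [mulVec_mulVec]

omit [DecidableEq m] [DecidableEq τ] in
/-- `G′` INVERTS `Δ` on `N(Q′)`: `G′(ΔNz) = Nz` (`B9SectECov.G'_mul_Δ_mul_kernel`, by name) — so `(Δ↾_{N(Q′)})⁻¹ = G′↾_R`.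
[folklore] -/
theorem G'_mulVec_Δ_kernel (hΔ' : IsUnit (B9H163.Δ' Δ Q a)) (N : Matrix n τ ℝ) (hQN : Q * N = 0) (z : τ → ℝ) :
    B9H163.G' Δ Q a *ᵥ (Δ *ᵥ (N *ᵥ z)) = N *ᵥ z := by
  have h := B9SectECov.G'_mul_Δ_mul_kernel Δ Q a hΔ' N hQN
  calc B9H163.G' Δ Q a *ᵥ (Δ *ᵥ (N *ᵥ z)) = (B9H163.G' Δ Q a * (Δ * N)) *ᵥ z := by
        simp only [mulVec_mulVec, ← Matrix.mul_assoc]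
    _ = N *ᵥ z := by rw [h]

omit [DecidableEq τ] in
/-- Hence `G′R(ΔNz) = Nz`: on the support of `δ(Q′λ′)` the operator `G′R` undoes `Δ`. [folklore] -/
theorem G'R_mulVec_Δ_kernel (hΔ' : IsUnit (B9H163.Δ' Δ Q a)) (N : Matrix n τ ℝ) (hQN : Q * N = 0) (z : τ → ℝ) :
    B9H163.G' Δ Q a *ᵥ (B9H163.R Δ Q a *ᵥ (Δ *ᵥ (N *ᵥ z))) = N *ᵥ z := by
  rw [R_mulVec_Δ_kernel Δ Q a hΔ' N hQN, G'_mulVec_Δ_kernel Δ Q a hΔ' N hQN]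

variable (hΔ : Δ.IsSymm) (hΔ' : IsUnit (B9H163.Δ' Δ Q a)) (N : Matrix n τ ℝ) (hQN : Q * N = 0)
  (hNA : IsUnit (Nᵀ * N).det) (hQM : IsUnit (Q * Qᵀ).det) (hT : IsUnit (Nᵀ * (Δ * Δ) * N).det)

include e hΔ hΔ' hQN hQM hT in
/-- `G′R = N(NᵀΔ²N)⁻¹NᵀΔ` (= `𝒢Δ`, `B9SectECov.eq_3172`), from `R = ΔN(NᵀΔ²N)⁻¹NᵀΔ` (`B9SectECov.R_eq_kernelBasis`) and
`G′ΔN = N`. [cite: Balaban1985BackgroundPropagators, (3.172) p.430] -/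
theorem G'R_eq : B9H163.G' Δ Q a * B9H163.R Δ Q a = N * (Nᵀ * (Δ * Δ) * N)⁻¹ * Nᵀ * Δ := by
  rw [B9SectECov.R_eq_kernelBasis e Δ Q a hΔ hΔ' N hQN hQM hT]
  simp only [← Matrix.mul_assoc]
  rw [Matrix.mul_assoc (B9H163.G' Δ Q a) Δ N, B9SectECov.G'_mul_Δ_mul_kernel Δ Q a hΔ' N hQN]

include e hΔ hΔ' hQN hQM hT in
/-- `Rf ∈ R = ΔN(Q′)` with explicit coordinates: `Rf = ΔN·((NᵀΔ²N)⁻¹NᵀΔf)` — the argument `RD*A + Δλ′` of `δ_R` lies in the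
subspace `R` on which `δ_R` is the δ-function. [cite: Balaban1985BackgroundPropagators, (3.20)-(3.21) p.394, (3.166) p.429] -/
theorem R_mulVec_mem (f : n → ℝ) :
    B9H163.R Δ Q a *ᵥ f = (Δ * N) *ᵥ (((Nᵀ * (Δ * Δ) * N)⁻¹ * Nᵀ * Δ) *ᵥ f) := by
  rw [B9SectECov.R_eq_kernelBasis e Δ Q a hΔ hΔ' N hQN hQM hT]
  simp only [mulVec_mulVec, ← Matrix.mul_assoc]

include e hΔ hΔ' hQN hNA hQM hT in
/-- THE POINT CUT OUT BY THE TWO δ-FUNCTIONS: `Q′λ = 0 ∧ Δλ = Rf ↔ λ = G′Rf` — existence ("`G′Δλ = λ` on `N(Q′)`",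
C-adv4-55) AND uniqueness (`Δ` injective on `N(Q′)`). [cite: Balaban1985BackgroundPropagators, (3.160),(3.166) p.429] -/
theorem point_core (f l : n → ℝ) :
    (Q *ᵥ l = 0 ∧ Δ *ᵥ l = B9H163.R Δ Q a *ᵥ f) ↔ l = (B9H163.G' Δ Q a * B9H163.R Δ Q a) *ᵥ f := by
  constructor
  · rintro ⟨hl, hΔl⟩
    obtain ⟨z, rfl⟩ : ∃ z : τ → ℝ, l = N *ᵥ z := ⟨_, kernel_eq_mulVec e Q N hQN hNA hQM hl⟩
    have h2 : B9H163.G' Δ Q a *ᵥ (Δ *ᵥ (N *ᵥ z)) = B9H163.G' Δ Q a *ᵥ (B9H163.R Δ Q a *ᵥ f) := by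
      rw [hΔl]
    rw [G'_mulVec_Δ_kernel Δ Q a hΔ' N hQN, mulVec_mulVec] at h2
    exact h2
  · intro hl
    rw [hl, G'R_eq e Δ Q a hΔ hΔ' N hQN hQM hT]
    refine ⟨?_, ?_⟩
    · have hQ : Q * (N * (Nᵀ * (Δ * Δ) * N)⁻¹ * Nᵀ * Δ) = 0 := by
        simp only [← Matrix.mul_assoc]; rw [hQN]; simp only [Matrix.zero_mul]
      rw [mulVec_mulVec, hQ, zero_mulVec]
    · rw [mulVec_mulVec, B9SectECov.R_eq_kernelBasis e Δ Q a hΔ hΔ' N hQN hQM hT]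
      simp only [← Matrix.mul_assoc]

include e hΔ hΔ' hQN hNA hQM hT in
/-- **(3.160), pointwise**: for every `f` (= `D*A`), the unique `λ ∈ N(Q̃′)` with `R̃f − Δλ = 0` is `λ = G̃′R̃f` (the same
theorem for the wavy data `Q̃′`, `R̃`, `G̃′`). [cite: Balaban1985BackgroundPropagators, (3.160) p.429] -/
theorem eq_3160_point (f l : n → ℝ) :
    (Q *ᵥ l = 0 ∧ B9H163.R Δ Q a *ᵥ f - Δ *ᵥ l = 0) ↔ l = (B9H163.G' Δ Q a * B9H163.R Δ Q a) *ᵥ f := by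
  rw [sub_eq_zero, eq_comm (a := B9H163.R Δ Q a *ᵥ f)]
  exact point_core e Δ Q a hΔ hΔ' N hQN hNA hQM hT f l

include e hΔ hΔ' hQN hNA hQM hT in
/-- **(3.166), the evaluation point**: `Q′λ′ = 0 ∧ Rf + Δλ′ = 0 ↔ λ′ = −G′Rf` — *"F(−G′RD\*A)"* with `f = D*A`.
[cite: Balaban1985BackgroundPropagators, (3.166) p.429] -/
theorem eq_3166_point (f l : n → ℝ) :
    (Q *ᵥ l = 0 ∧ B9H163.R Δ Q a *ᵥ f + Δ *ᵥ l = 0) ↔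
      l = -((B9H163.G' Δ Q a * B9H163.R Δ Q a) *ᵥ f) := by
  have h := point_core e Δ Q a hΔ hΔ' N hQN hNA hQM hT f (-l)
  rw [mulVec_neg, mulVec_neg, neg_eq_zero, eq_comm (a := -(Δ *ᵥ l)), eq_neg_iff_add_eq_zero,
    neg_eq_iff_eq_neg] at h
  exact h

include hΔ hΔ' hQN hNA hT in
/-- **(3.166) AT MEASURE LEVEL.**  For every `Φ(w, λ′)` — the print's "arbitrary function F(λ′)", allowed to depend on
`A` through the outer variable `w = RD*A ∈ R` as the rest of (3.161) does —
`∫_{N(Q′)} Φ(−Δλ′, λ′) dλ′ = |det(Δ↾_{N(Q′)})|⁻¹ · ∫_R Φ(w, −G′Rw) dw`, `R = ΔN(Q′)`: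
the left side is `∫_R dw ∫dλ′ δ(Q′λ′)δ_R(w + Δλ′)Φ(w, λ′)` with the `w`-integration over the subspace `R` done first
(`δ_R` in its own variable = evaluation at `w = −Δλ′`), the right side is `∫_R dw` of the printed right member
`|det(Δ↾_{N(Q′)})|⁻¹Φ(w, −G′Rw)`.  Proof: `λ′ ↦ −λ′`, `G′RΔ = 1` on `N(Q′)`, and the change of variables `eq_3160_inv`.
[cite: Balaban1985BackgroundPropagators, (3.166) p.429] -/
theorem eq_3166 (Φ : (n → ℝ) → (n → ℝ) → ℝ) :
    subInt N (fun l => Φ (-(Δ *ᵥ l)) l) =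
      (absDetOn Δ N)⁻¹ *
        subInt (Δ * N) (fun w => Φ w (-(B9H163.G' Δ Q a *ᵥ (B9H163.R Δ Q a *ᵥ w)))) := by
  have hΔN : IsUnit ((Δ * N)ᵀ * (Δ * N)).det := by rwa [gram_image Δ hΔ N]
  have h1 := subInt_comp_neg N (fun l => Φ (Δ *ᵥ l) (-l))
  simp only [mulVec_neg, neg_neg] at h1
  have h2 : subInt N (fun l => Φ (Δ *ᵥ l) (-l)) =
      subInt N (fun l => Φ (Δ *ᵥ l) (-(B9H163.G' Δ Q a *ᵥ (B9H163.R Δ Q a *ᵥ (Δ *ᵥ l))))) := by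
    unfold subInt
    congr 1
    congr 1
    funext z
    beta_reduce
    rw [G'R_mulVec_Δ_kernel Δ Q a hΔ' N hQN]
  rw [h1, h2]
  exact eq_3160_inv Δ N hNA hΔN (fun w => Φ w (-(B9H163.G' Δ Q a *ᵥ (B9H163.R Δ Q a *ᵥ w))))

include hΔ hΔ' hQN hNA hT in
/-- (3.166) in the printed shape, `F` a function of `λ′` alone and `ψ` a test function of `w = RD*A`:
`∫_{N(Q′)} ψ(−Δλ′)F(λ′) dλ′ = |det(Δ↾_{N(Q′)})|⁻¹ ∫_R ψ(w)F(−G′Rw) dw`. [cite: Balaban1985BackgroundPropagators, (3.166) p.429] -/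
theorem eq_3166_F (ψ F : (n → ℝ) → ℝ) :
    subInt N (fun l => ψ (-(Δ *ᵥ l)) * F l) =
      (absDetOn Δ N)⁻¹ *
        subInt (Δ * N) (fun w => ψ w * F (-(B9H163.G' Δ Q a *ᵥ (B9H163.R Δ Q a *ᵥ w)))) :=
  eq_3166 Δ Q a hΔ hΔ' N hQN hNA hT (fun w l => ψ w * F l)

omit [DecidableEq n] in
include hΔ hNA hT in
/-- Under the standing hypotheses the Jacobian of (3.166) is a positive number: `0 < |det(Δ↾_{N(Q′)})|`.
[cite: Balaban1985BackgroundPropagators, (3.166) p.429] -/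
theorem absDetOn_kernel_pos : 0 < absDetOn Δ N :=
  absDetOn_pos Δ N hNA (by rwa [gram_image Δ hΔ N])

end Eq3166

/-! ## §5  (3.161), (3.165), (3.167): the pointwise bookkeeping, with an abstract derivative `D`, `Δ = D*D` -/

section Bookkeeping

variable {n m τ b : Type*} [Fintype n] [Fintype m] [Fintype τ] [Fintype b] [DecidableEq n] [DecidableEq m]

omit [DecidableEq n] in
/-- (3.161), first substitution: under `A → A + Dλ`, `RD*(A + Dλ) = RD*A + RΔλ` with `Δ = D*D` ((3.23)) — the factor
`δ_R(RD*A + RΔλ)` of (3.161) (PRINTED with the subscript `R̃` — the slip stated in the header, v1.1), for ANY linear `R`.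
[cite: Balaban1985BackgroundPropagators, (3.161) p.429] -/
theorem eq_3161_R (Rm : Matrix n n ℝ) (D : Matrix b n ℝ) (A : b → ℝ) (lam : n → ℝ) :
    Rm *ᵥ (Dᵀ *ᵥ (A + D *ᵥ lam)) = Rm *ᵥ (Dᵀ *ᵥ A) + Rm *ᵥ ((Dᵀ * D) *ᵥ lam) := by
  simp only [mulVec_add, ← mulVec_mulVec]

/-- (3.161), second substitution (the reason for the sign in (3.160)): for `λ = Ñz ∈ N(Q̃′)`,
`R̃D*(A + Dλ) − Δλ = R̃D*A`, since `R̃Δλ = Δλ` on `N(Q̃′)` — the factor `δ_R̃(R̃D*A)` of (3.161) (PRINTED with the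
subscript `R` — the slip stated in the header, v1.1; p. 430 (3.167) prints `δ_R̃(R̃D*A)`).
[cite: Balaban1985BackgroundPropagators, (3.161) p.429] -/
theorem eq_3161_wavy (D : Matrix b n ℝ) (Q : Matrix m n ℝ) (a : ℝ) (hΔ' : IsUnit (B9H163.Δ' (Dᵀ * D) Q a))
    (N : Matrix n τ ℝ) (hQN : Q * N = 0) (A : b → ℝ) (z : τ → ℝ) :
    B9H163.R (Dᵀ * D) Q a *ᵥ (Dᵀ *ᵥ (A + D *ᵥ (N *ᵥ z))) - (Dᵀ * D) *ᵥ (N *ᵥ z) =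
      B9H163.R (Dᵀ * D) Q a *ᵥ (Dᵀ *ᵥ A) := by
  have h1 : Dᵀ *ᵥ (A + D *ᵥ (N *ᵥ z)) = Dᵀ *ᵥ A + (Dᵀ * D) *ᵥ (N *ᵥ z) := by
    simp only [mulVec_add, ← mulVec_mulVec]
  rw [h1, mulVec_add, R_mulVec_Δ_kernel (Dᵀ * D) Q a hΔ' N hQN, add_sub_cancel_right]

/-- **(3.165)**, first: `Q′(λ′ + H′μ) − μ = Q′λ′` (so `δ(Q′λ − μ) = δ(Q′λ′)` and `D̄Q′λ = D̄Q′λ′ + D̄μ`), `H′` = the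
operator (3.163) = (3.164) ([adv1's] `B9H163.H163`, `= Hmin` by `B9H163.H163_eq_Hmin`; `Q′H′ = 1` is `B9H163.Q_mul_H163`).
[cite: Balaban1985BackgroundPropagators, (3.165) p.429] -/
theorem eq_3165_constraint (Δ : Matrix n n ℝ) (Q : Matrix m n ℝ) (a : ℝ) (hM' : IsUnit (B9H163.M' Δ Q a))
    (l : n → ℝ) (μ : m → ℝ) : Q *ᵥ (l + B9H163.H163 Δ Q a *ᵥ μ) - μ = Q *ᵥ l := by
  rw [mulVec_add, mulVec_mulVec, B9H163.Q_mul_H163 hM', one_mulVec, add_sub_cancel_right]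

/-- **(3.165)**, third: `RΔ(λ′ + H′μ) = RΔλ′ = Δλ′` for `λ′ = Nz ∈ N(Q′)` (`RΔH′ = 0` is [adv1's] `B9H163.R_mul_Δ_mul_H163`,
`RΔλ′ = Δλ′` is `R_mulVec_Δ_kernel`). [cite: Balaban1985BackgroundPropagators, (3.165) p.429] -/
theorem eq_3165_R (Δ : Matrix n n ℝ) (Q : Matrix m n ℝ) (a : ℝ) (hΔ' : IsUnit (B9H163.Δ' Δ Q a))
    (hM' : IsUnit (B9H163.M' Δ Q a)) (N : Matrix n τ ℝ) (hQN : Q * N = 0) (z : τ → ℝ) (μ : m → ℝ) :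
    B9H163.R Δ Q a *ᵥ (Δ *ᵥ (N *ᵥ z + B9H163.H163 Δ Q a *ᵥ μ)) = Δ *ᵥ (N *ᵥ z) := by
  have h0 : B9H163.R Δ Q a *ᵥ (Δ *ᵥ (B9H163.H163 Δ Q a *ᵥ μ)) = 0 := by
    calc B9H163.R Δ Q a *ᵥ (Δ *ᵥ (B9H163.H163 Δ Q a *ᵥ μ))
        = (B9H163.R Δ Q a * (Δ * B9H163.H163 Δ Q a)) *ᵥ μ := by
          simp only [mulVec_mulVec, ← Matrix.mul_assoc]
      _ = 0 := by rw [B9H163.R_mul_Δ_mul_H163 hΔ' hM', zero_mulVec]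
  rw [mulVec_add, mulVec_add, R_mulVec_Δ_kernel Δ Q a hΔ' N hQN, h0, add_zero]

/-- **(3.167)**, the configuration in the exponent: at the evaluation point `λ′ = −G′RD*A` of (3.166) the gauge-transformed
and translated field is `A + D(λ′ + H′μ) = A − DG′RD*A + DH′μ`. [cite: Balaban1985BackgroundPropagators, (3.167) p.430] -/
theorem eq_3167_config (Δ : Matrix n n ℝ) (Q : Matrix m n ℝ) (a : ℝ) (D : Matrix b n ℝ) (A : b → ℝ) (μ : m → ℝ)
    {l : n → ℝ} (hl : l = -((B9H163.G' Δ Q a * B9H163.R Δ Q a) *ᵥ (Dᵀ *ᵥ A))) :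
    A + D *ᵥ (l + B9H163.H163 Δ Q a *ᵥ μ) =
      A - (D * B9H163.G' Δ Q a * B9H163.R Δ Q a * Dᵀ) *ᵥ A + (D * B9H163.H163 Δ Q a) *ᵥ μ := by
  subst hl
  simp only [mulVec_add, mulVec_neg, mulVec_mulVec, ← Matrix.mul_assoc, sub_eq_add_neg, add_assoc]

end Bookkeeping

end

end Literature.MathematicalPhysics.QuantumFieldTheory.Balaban1983to89.B9Eq3166
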